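import Summits.SmoothPoincare4.SmoothPoincare4.Theorems.CongruenceShadowsShadowApproximationEpiClassLivingstonDefs
import Literature.Topology.FourManifolds.HandlebodyGroupRealisation

/-!
# Stub `stub_handlebodyRealisation` of line `free-shadow-tsystem` for crux
`CongruenceShadows.ShadowApproximation` (item stmt-SmoothPoincare4-14595, route
route-SmoothPoincare4-CongruenceShadows) — handlebody realisation
`Stab_{Aut S}(N 0) ↠ Aut (S ⧸ N 0)`

Proves the registered stub **`stub_handlebodyRealisation`** verbatim: for every `m` and every
automorphism `θ` of `F = S ⧸ N 0` (`S = SurfaceGroup (3+3m)`, `N = s4Kernels.stabilizeIter m` the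
standard `(3+3m; m+1)` kernel triple of `S⁴`, `F = π₁(H₀)` free of rank `3(m+1)`), there is an
automorphism `β` of `S` with `β(N 0) = N 0` inducing `θ` on the nose.

* §1 `stabilizeIter_zero_eq_cutKernel` — the standard kernel `N 0` is the CUT KERNEL
  `⟪a_{3j}, a_{3j+1}, b_{3j+2} : j ≤ m⟫` (`SurfaceGroup.cutKernel` of `i ↦ (i ≡ 2 mod 3)`, one
  generator per handle), by induction on `m` along `TrisectionKernels.stabilize_apply` /
  `stabSet`: the generators on the first `3+3n` handles push forward along `genIncl`, those of
  `s4Kernels 0 = ⟪a₀, a₁, b₂⟫` along `genShift`, and conversely every element of `stabSet` dies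
  modulo the cut kernel because `genIncl`/`genShift` descend to the surface groups modulo it
  (`surfaceRelator_add_three`; the cut meets every new handle).
* §2 the stub, from the Literature theorem
  `SurfaceGroup.exists_mulEquiv_map_cutKernel_eq` (`HandlebodyGroupRealisation.lean`: Griffiths
  1964 / Zieschang 1964 — every automorphism of `S_g ⧸ ⟪cut system⟫` lifts to `Aut S_g`
  stabilising the kernel; proved there from Nielsen's generators of `Aut F_g` and explicit
  handle slides in `S_g`).
-/

noncomputable section

-- the prescribed namespace `Summit.<P>.<Sub>.…` duplicates `SmoothPoincare4` (P = Sub)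
set_option linter.dupNamespace false

namespace Summit.SmoothPoincare4.SmoothPoincare4.Theorems.ShadowApproximation.FreeShadowTsystem

open Literature.Topology.FourManifolds Subgroup

/-! ## §1 The standard kernel `N 0` is a cut kernel -/

/-- `s4Kernels 0 = ⟪a₀, a₁, b₂⟫` is the cut kernel of the cut system `i ↦ (i ≡ 2 mod 3)` (kill `bᵢ`
on handle `2`, `aᵢ` on handles `0, 1`). [folklore] -/
theorem s4Kernels_zero_eq_cutKernel :
    s4Kernels 0 = SurfaceGroup.cutKernel (fun i : Fin 3 => decide ((i : ℕ) % 3 = 2)) := by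
  show normalClosure {SurfaceGroup.a 0, SurfaceGroup.a 1, SurfaceGroup.b 2} = _
  unfold SurfaceGroup.cutKernel
  congr 1
  ext x
  simp only [Set.mem_insert_iff, Set.mem_singleton_iff, Set.mem_range]
  constructor
  · rintro (rfl | rfl | rfl)
    · exact ⟨0, rfl⟩
    · exact ⟨1, rfl⟩
    · exact ⟨2, rfl⟩
  · rintro ⟨i, rfl⟩
    fin_cases i
    · exact Or.inl rfl
    · exact Or.inr (Or.inl rfl)
    · exact Or.inr (Or.inr rfl)

/-- One stabilisation step: if `K 0` and `s4Kernels 0` are cut kernels, so is `K.stabilize 0`, for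
the juxtaposed cut system. [folklore] -/
theorem stabilize_zero_eq_cutKernel {g : ℕ} (K : TrisectionKernels g) (c : Fin g → Bool)
    (c₃ : Fin 3 → Bool) (hK : K 0 = SurfaceGroup.cutKernel c)
    (h₃ : s4Kernels 0 = SurfaceGroup.cutKernel c₃) :
    K.stabilize 0 = SurfaceGroup.cutKernel (Fin.append c c₃) := by
  rw [TrisectionKernels.stabilize_apply, hK, h₃]
  -- the quotient by the target kernel and the two descended maps
  set N' := SurfaceGroup.cutKernel (Fin.append c c₃) with hN'
  let π' := QuotientGroup.mk' N'
  have hincl : ∀ j : Fin g,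
      π' (PresentedGroup.of (Fin.castAdd 3 j, c j)) = 1 := fun j => by
    rw [QuotientGroup.mk'_apply, QuotientGroup.eq_one_iff]
    have := SurfaceGroup.of_mem_cutKernel (Fin.append c c₃) (Fin.castAdd 3 j)
    rwa [Fin.append_left] at this
  have hshift : ∀ j : Fin 3,
      π' (PresentedGroup.of (Fin.natAdd g j, c₃ j)) = 1 := fun j => by
    rw [QuotientGroup.mk'_apply, QuotientGroup.eq_one_iff]
    have := SurfaceGroup.of_mem_cutKernel (Fin.append c c₃) (Fin.natAdd g j)
    rwa [Fin.append_right] at this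
  -- `genShift` kills `r₃` modulo `N'`
  have hΦ' : (π'.comp ((PresentedGroup.mk _).comp (genShift g))) (surfaceRelator 3) = 1 := by
    have : π'.comp ((PresentedGroup.mk _).comp (genShift g)) =
        FreeGroup.lift fun p : surfaceGen 3 =>
          π' (PresentedGroup.of (Fin.natAdd g p.1, p.2)) :=
      FreeGroup.ext_hom _ _ fun p => by simp [PresentedGroup.of]
    rw [this]
    refine SurfaceGroup.lift_surfaceRelator_eq_one_of_hits _ fun j => ?_
    cases hc : c₃ j
    · exact Or.inl (by simpa [hc] using hshift j)
    · exact Or.inr (by simpa [hc] using hshift j)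
  -- `genIncl` kills `r_g` modulo `N'`
  have hΦ : (π'.comp ((PresentedGroup.mk _).comp (genIncl g))) (surfaceRelator g) = 1 := by
    have hrel : (PresentedGroup.mk ({surfaceRelator (g + 3)} : Set (FreeGroup (surfaceGen (g + 3))))
        (genIncl g (surfaceRelator g))) *
          PresentedGroup.mk _ (genShift g (surfaceRelator 3)) = 1 := by
      rw [← map_mul, ← surfaceRelator_add_three]
      exact PresentedGroup.one_of_mem (Set.mem_singleton _)
    rw [MonoidHom.comp_apply, MonoidHom.comp_apply, eq_inv_of_mul_eq_one_left hrel, map_inv,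
      inv_eq_one]
    exact hΦ'
  apply le_antisymm
  · refine normalClosure_le_normal ?_
    rintro s (⟨x, hx, rfl⟩ | ⟨x, hx, rfl⟩)
    · -- first `g` handles
      let φ : SurfaceGroup g →* SurfaceGroup (g + 3) ⧸ N' :=
        presentedLift (π'.comp ((PresentedGroup.mk _).comp (genIncl g))) (by
          intro r hr
          rw [Set.mem_singleton_iff] at hr
          subst hr
          exact hΦ)
      have hker : SurfaceGroup.cutKernel c ≤ φ.ker := by
        refine normalClosure_le_normal ?_
        rintro _ ⟨j, rfl⟩
        show φ (PresentedGroup.of (j, c j)) = 1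
        simpa [φ, PresentedGroup.of] using hincl j
      have := hker hx
      rw [MonoidHom.mem_ker, presentedLift_mk] at this
      simpa [π'] using this
    · -- last three handles
      let φ : SurfaceGroup 3 →* SurfaceGroup (g + 3) ⧸ N' :=
        presentedLift (π'.comp ((PresentedGroup.mk _).comp (genShift g))) (by
          intro r hr
          rw [Set.mem_singleton_iff] at hr
          subst hr
          exact hΦ')
      have hker : SurfaceGroup.cutKernel c₃ ≤ φ.ker := by
        refine normalClosure_le_normal ?_
        rintro _ ⟨j, rfl⟩
        show φ (PresentedGroup.of (j, c₃ j)) = 1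
        simpa [φ, PresentedGroup.of] using hshift j
      have := hker hx
      rw [MonoidHom.mem_ker, presentedLift_mk] at this
      simpa [π'] using this
  · refine normalClosure_le_normal ?_
    rintro _ ⟨i, rfl⟩
    induction i using Fin.addCases with
    | left j =>
      simp only [Fin.append_left]
      refine subset_normalClosure (Or.inl ⟨FreeGroup.of (j, c j), ?_, by simp [PresentedGroup.of]⟩)
      exact SurfaceGroup.of_mem_cutKernel c j
    | right j =>
      simp only [Fin.append_right]
      refine subset_normalClosure (Or.inr ⟨FreeGroup.of (j, c₃ j), ?_, by simp [PresentedGroup.of]⟩)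
      exact SurfaceGroup.of_mem_cutKernel c₃ j

/-- **The standard kernel `N 0 = s4Kernels.stabilizeIter m 0` is the cut kernel
`⟪a_{3j}, a_{3j+1}, b_{3j+2} : j ≤ m⟫** (the cut system of the first handlebody of the standard
trisection of `S⁴`: on handle `i` kill `bᵢ` if `i ≡ 2 (mod 3)` and `aᵢ` otherwise). [folklore] -/
theorem stabilizeIter_zero_eq_cutKernel (m : ℕ) :
    s4Kernels.stabilizeIter m 0 =
      SurfaceGroup.cutKernel (fun i : Fin (3 + 3 * m) => decide ((i : ℕ) % 3 = 2)) := by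
  induction m with
  | zero => exact s4Kernels_zero_eq_cutKernel
  | succ n ih =>
    show (s4Kernels.stabilizeIter n).stabilize 0 =
      SurfaceGroup.cutKernel (fun i : Fin (3 + 3 * n + 3) => decide ((i : ℕ) % 3 = 2))
    rw [stabilize_zero_eq_cutKernel _ _ _ ih s4Kernels_zero_eq_cutKernel]
    congr 1
    funext i
    induction i using Fin.addCases with
    | left j => rw [Fin.append_left]; simp
    | right j =>
      rw [Fin.append_right]
      simp only [Fin.val_natAdd, decide_eq_decide]
      omega

/-! ## §2 The stub -/

/-- **Stub `stub_handlebodyRealisation` (handlebody realisation, Zieschang–Griffiths–Luft).**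
Every automorphism `θ` of `F = S ⧸ N 0 = π₁(H₀)` is induced by an automorphism `β` of the surface
group `S = SurfaceGroup (3+3m)` with `β(N 0) = N 0`: `π ∘ β = θ ∘ π` on the nose.  From
`stabilizeIter_zero_eq_cutKernel` (`N 0` is a cut kernel) and the Literature theorem
`SurfaceGroup.exists_mulEquiv_map_cutKernel_eq` (lift Nielsen's generators of
`Aut F_{3(m+1)}` by inversions and handle slides of `S`, transport along the cut swap).
[cite: GriffithsHB1964Handlebody, main theorem] -/
theorem stub_handlebodyRealisation :
    ∀ (m : ℕ) (θ : (SurfaceGroup (3 + 3 * m) ⧸ s4Kernels.stabilizeIter m 0) ≃*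
        (SurfaceGroup (3 + 3 * m) ⧸ s4Kernels.stabilizeIter m 0)),
      ∃ β : SurfaceGroup (3 + 3 * m) ≃* SurfaceGroup (3 + 3 * m),
        (s4Kernels.stabilizeIter m 0).map β.toMonoidHom = s4Kernels.stabilizeIter m 0 ∧
        ∀ s : SurfaceGroup (3 + 3 * m),
          QuotientGroup.mk' (s4Kernels.stabilizeIter m 0) (β s) =
            θ (QuotientGroup.mk' (s4Kernels.stabilizeIter m 0) s) :=
  fun m θ => SurfaceGroup.exists_mulEquiv_map_cutKernel_eq _ _ (stabilizeIter_zero_eq_cutKernel m) θ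

end Summit.SmoothPoincare4.SmoothPoincare4.Theorems.ShadowApproximation.FreeShadowTsystem

end
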